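import Summits.QuantumFields.BalabanUV.Beta.SymRootedMixedTableLaw
import Summits.QuantumFields.BalabanUV.Beta.MultiplierTableSlot
import Summits.QuantumFields.BalabanUV.Beta.E3ContactGenerator
import Summits.QuantumFields.BalabanUV.Beta.DshAn1
import Summits.QuantumFields.BalabanUV.Beta.ChartConjugation
import Summits.QuantumFields.BalabanUV.Beta.E3LevelOneReflection

/-!
# `BalabanUV.Beta.SymMixedReflectionLetterAn1` — binder row D1: THE hR TABLE REFLECTION LETTER (hM2) OF THE ROOT AT an1's CLOSED RECORD,
# DISCHARGED from an1's packed mixed reflection law `SymRootedMixedTableLaw.symTableLaw` with an EXPLICIT remainder `symRMrAn1`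

HONEST FRAMING (cell contract, verbatim): «discharging `BetaPertH` makes Bałaban's UV stability UNCONDITIONAL — a real constructive-QFT
result; it is NOT the continuum limit and NOT the Clay problem.»  THIS MODULE DISCHARGES NOTHING of `BetaPertH` and NO root-level CLASS
of row D1 (classes 0∕5 unchanged).  It is the `M2Of` ∕ `conjV (M1Of …)` REPACKING announced in an1-g43's `SymRootedMixedTableLaw` header:
the binder `hM2` of the roots `RowD1JointEndSymReflTablesAn1(S2).d1Drift_JsB12Sym_an1Tables(S2)_of_bordMixLetters_reflTableLetters_D1Tel_D1Rep`
(p286410 ∕ p288196) — the axis-reflection letter of the level-`j` mixed table `M2Of 3 Lc (symMixFFAt ρ_c Lc) j` with a FREE remainder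
`RMr` — holds with the DISPLAYED remainder `RMr := symRMrAn1 Lc cΛ γ` below, for EVERY `cΛ`, `γ`, by `symTableLaw` and module algebra.
What this does NOT do: it does not touch the root's `hsplit` ∕ `hDg` (where `RMr` re-enters), says nothing about the VALUE or the localisation
of `symRMrAn1`, and discharges no (T2-B)(T2-M₂)(V-r)(H-r) letter.  [folklore] algebra over [our objects]; 0 sorry; nothing cited as a fact.
NOT D1, NOT BetaPertH, NOT continuum, NOT Clay.

* `symRMrAn1 Lc cΛ γ j α κ u ρ w := wM2 3 Lc j • (2 • diagK (ctGen 3 α Lc κ u) ∘ symHessFFAt ρ_c Lc ρ w + (2·[ρ = α]·symLinKerAt ρ_c Lc ρ w (κ,u)) •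
  symHessFFAt ρ_c Lc ρ w) − conjV (M1Of 3 Lc (symHessFFAt ρ_c Lc) cΛ j ρ w) (diagK (γ j · ctGenM 3 (bhK Lc + Dsh Lc) α Lc κ u))` — [our object];
* `hM2_symMixFFAt` — the root's `hM2` binder VERBATIM at `mixFF := symMixFFAt (ctr 4 Lc) Lc`, `RMr := symRMrAn1 Lc cΛ γ` (`Lc` odd).
HONEST DEPENDENCY (verbatim): «continuum YM on T⁴ ⇐ BetaPertH ∧ nine spine estimates (0/9 proved); BetaPertH ⇐ (D1) ∧ (D4) ∧ CAP+tail;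
G-an2-4 gates asym, D1 and NE2/3/4.»  ABSOLUTE RULE (cell, verbatim): «No internally-minted statement may enter as a cited fact. Every
hypothesis is either kernel-proved in this package or a verbatim quotation of a PUBLISHED theorem with page reference.»
Provenance: β sub-cell, BINDER row D1 OWNER `b2b-balaban-beta-an2` gen 31, 2026-08-21; over an1-g43's `SymRootedMixedTableLaw` (S2d) BY NAME.
-/

noncomputable section

open Literature.MathematicalPhysics.QuantumFieldTheory.Balaban1983to89
open Literature.MathematicalPhysics.QuantumFieldTheory.Balaban1983to89.Beta
open ExpKernelCalculus (MKer comp)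
open PolarizationSign (reflSign)
open KernelReflection (refK)
open ResolventReflection (bref Φ)
open AveragingContoursRooted (ctr)
open OneStepResolventKernel (Fib)
open BalabanStepW2 (M2Of wM2)
open Summit.QuantumFields.BalabanUV.Beta.ChartConjugation (conjV)
open Summit.QuantumFields.BalabanUV.Beta.SpineRooted (M1Of)
open Summit.QuantumFields.BalabanUV.Beta.BorderedHessian (bhK diagK ctGen)
open Summit.QuantumFields.BalabanUV.Beta.E3ContactGenerator (ctGenM)
open Summit.QuantumFields.BalabanUV.Beta.DshAn1 (Dsh)
open Summit.QuantumFields.BalabanUV.Beta.SymAveragingHessianCounts (symLinKerAt symHessFFAt)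
open Summit.QuantumFields.BalabanUV.Beta.SymAveragingMixedJetTables (symMixFFAt)
open Summit.QuantumFields.BalabanUV.Beta.SymRootedMixedTableLaw (symTableLaw)
open Summit.QuantumFields.BalabanUV.Beta.E3LevelOneReflection (refK_smul)

namespace Summit.QuantumFields.BalabanUV.Beta.SymMixedReflectionLetterAn1

open Classical in
/-- [our object] **THE EXPLICIT MIXED REFLECTION REMAINDER** of the level-`j` mixed table of an1's closed record against the root's
`conjV (M1Of …) (diagK (γ_j·ctGenM …))` contact: the two displayed contact words of `symTableLaw` scaled by `wM2 3 Lc j`, minus the root's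
contact word.  A NAME for a displayed kernel; nothing about its size is asserted. -/
def symRMrAn1 (Lc : ℕ) (cΛ : ℝ) (γ : ℕ → ℝ) (j : ℕ) (α κ : Fin 4) (u : Fin 4 → ℤ) (ρ : Fin 4) (w : Fin 4 → ℤ) : MKer 4 (Fib 3) :=
  wM2 3 Lc j • ((2 : ℝ) • comp (diagK (ctGen 3 α Lc κ u)) (symHessFFAt (ctr 4 Lc) Lc ρ w)
      + (2 * (if ρ = α then symLinKerAt (ctr 4 Lc) Lc ρ w (κ, u) else 0)) • symHessFFAt (ctr 4 Lc) Lc ρ w)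
    - conjV (M1Of 3 Lc (symHessFFAt (ctr 4 Lc) Lc) cΛ j ρ w) (diagK fun p c => γ j * ctGenM 3 (bhK Lc + Dsh Lc) α Lc κ u p c)

open Classical in
/-- [folklore] **THE ROOT's hR MIXED TABLE REFLECTION LETTER (hM2) AT an1's CLOSED RECORD HOLDS with `RMr := symRMrAn1 Lc cΛ γ`** (`Lc` odd;
every `cΛ`, `γ`): the binder `hM2` of `RowD1JointEndSymReflTablesAn1S2.d1Drift_JsB12Sym_an1TablesS2_of_…` verbatim at
`mixFF := symMixFFAt (ctr 4 Lc) Lc` — from an1's `SymRootedMixedTableLaw.symTableLaw` by unfolding `M2Of` and module algebra. -/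
theorem hM2_symMixFFAt {Lc : ℕ} (hLc : Odd Lc) (cΛ : ℝ) (γ : ℕ → ℝ) :
    ∀ (j : ℕ) (α κ : Fin 4) (u : Fin 4 → ℤ) (ρ : Fin 4) (w : Fin 4 → ℤ),
      M2Of 3 Lc (symMixFFAt (ctr 4 Lc) Lc) j κ (bref α κ u) ρ (bref α ρ w) =
        (reflSign α κ * reflSign α ρ) • refK (Φ Lc α)
          (M2Of 3 Lc (symMixFFAt (ctr 4 Lc) Lc) j κ u ρ w
            + conjV (M1Of 3 Lc (symHessFFAt (ctr 4 Lc) Lc) cΛ j ρ w) (diagK fun p c => γ j * ctGenM 3 (bhK Lc + Dsh Lc) α Lc κ u p c)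
            + symRMrAn1 Lc cΛ γ j α κ u ρ w) := by
  intro j α κ u ρ w
  have h := symTableLaw hLc α κ u ρ w
  have e1 : M2Of 3 Lc (symMixFFAt (ctr 4 Lc) Lc) j κ u ρ w
        + conjV (M1Of 3 Lc (symHessFFAt (ctr 4 Lc) Lc) cΛ j ρ w) (diagK fun p c => γ j * ctGenM 3 (bhK Lc + Dsh Lc) α Lc κ u p c)
        + symRMrAn1 Lc cΛ γ j α κ u ρ w =
      wM2 3 Lc j • (symMixFFAt (ctr 4 Lc) Lc κ u ρ w
        + (2 : ℝ) • comp (diagK (ctGen 3 α Lc κ u)) (symHessFFAt (ctr 4 Lc) Lc ρ w)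
        + (2 * (if ρ = α then symLinKerAt (ctr 4 Lc) Lc ρ w (κ, u) else 0)) • symHessFFAt (ctr 4 Lc) Lc ρ w) := by
    simp only [symRMrAn1, M2Of, smul_add]
    abel
  have e2 : M2Of 3 Lc (symMixFFAt (ctr 4 Lc) Lc) j κ (bref α κ u) ρ (bref α ρ w) =
      wM2 3 Lc j • symMixFFAt (ctr 4 Lc) Lc κ (bref α κ u) ρ (bref α ρ w) := rfl
  rw [e1, e2, refK_smul, smul_smul, mul_comm, ← smul_smul, ← h]

end Summit.QuantumFields.BalabanUV.Beta.SymMixedReflectionLetterAn1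

end
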